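import Summits.MatrixMultiplication.OmegaCensus.ThreeSetLinePackedCorrelation
import Mathlib.Algebra.BigOperators.Intervals
import HarnessLib

/-!
# Packed group-ring arithmetic for `ℤ_{≥0}[C_p]`, I: the numeral primitives and the `enc` lemmas (toolkit for the norm filter)

ω-census `pub-omega`, family (b3), seat pub-omega-group gen 41.  Framing: lottery ticket; floor = certified bounds/negative
ranges.  VALUE: a kernel TOOL (the arithmetic layer of the certificate-free norm filter `ThreeSetLineNormDivisibility`); NOT
progress on ω.

A non-negative element of the group ring `ℤ[C_p]` is held as ONE numeral `a = Σ_{v<p} a_v X^v` (`X` a large power of two; the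
digit list is `dl p X a`); `Phi a = Σ_{v<p} a_v ρ^v ∈ S` is its image in `S = AdjoinRoot (cyclotomic p ℤ)` and `mass a = Σ a_v`.
Every primitive costs `O(1)` or `O(p)` kernel operations on numerals (no `p × p` work):
* `ofList X F` (= `LineInv.enc`): `Phi = Σ F(v) ρ^v = lev ρ F`, `mass = Σ F` (`Phi_ofList`, `mass_ofList`);
* `cmul p X a b = (ab) mod X^p + (ab) div X^p` — the CYCLIC product: `Phi (cmul a b) = Phi a · Phi b` and
  `mass (cmul a b) = mass a · mass b` whenever `mass a · mass b < X` (`Phi_cmul`, `mass_cmul`; via `LineInv.enc_lconv`);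
* `nadd a b = a + b`: `Phi`- and `mass`-additive when `mass a + mass b < X` (`Phi_nadd`, `mass_nadd`);
* `perm p X gi a` — the digit permutation `u ↦ a_{gi·u}`: `Phi (perm gi a) = σ_g (Phi a)` for `g·gi ≡ 1 (mod p)`, `mass` unchanged
  (`Phi_perm`, `mass_perm`);
* `readInt p X a = a₀ − a₁` with the check `a₁ = a₂ = ⋯ = a_{p−1}` (`isConst`): then `Phi a = readInt a` (`Phi_eq_readInt`).
This file: the pure-`ℕ` definitions and the packing lemmas (`encR`, `enc_mod_pow`, `enc_div_pow`, `enc_dl`, …); the semantics in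
`S` (`Phi_*`, `mass_*`) are in `ThreeSetLinePackedCyclotomic`.
-/

namespace Summit.MatrixMultiplication.OmegaCensus

open Finset LineInv

namespace LineNorm

/-! ## Definitions (pure `ℕ`) -/

/-- The digit list (length `p`, base `X`) of a numeral. [folklore] -/
def dl (p X a : ℕ) : List ℕ := (List.range p).map fun v => a / X ^ v % X

/-- Digit sum. [folklore] -/
def mass (p X a : ℕ) : ℕ := (dl p X a).sum

/-- Packing a count vector (little-endian base `X`). [folklore] -/
def ofList (X : ℕ) (F : List ℕ) : ℕ := enc X F

/-- Cyclic product of two packed group-ring elements: fold the linear product at `X^p`. [folklore] -/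
def cmul (p X a b : ℕ) : ℕ := a * b % X ^ p + a * b / X ^ p

/-- Digit permutation: digit `u` of the result is digit `gi·u mod p` of `a`. [folklore] -/
def perm (p X gi a : ℕ) : ℕ := enc X ((List.range p).map fun u => a / X ^ (gi * u % p) % X)

/-- All digits `1 … p−1` equal digit `1`. [folklore] -/
def isConst (p X a : ℕ) : Bool := (List.range p).all fun v => v = 0 || a / X ^ v % X == a / X % X

/-- The integer `a₀ − a₁`. [folklore] -/
def readInt (X a : ℕ) : ℤ := ((a % X : ℕ) : ℤ) - ((a / X % X : ℕ) : ℤ)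

/-! ## Generic facts about `enc` (base `X`) -/

section Enc

variable {X : ℕ}

/-- Evaluation of a coefficient list at a ring element, same recursion as `enc`. [folklore] -/
def encR {R : Type*} [CommRing R] (x : R) : List ℕ → R
  | [] => 0
  | a :: l => (a : R) + x * encR x l

/-- `encR` is additive on `ladd`. [folklore] -/
theorem encR_ladd {R : Type*} [CommRing R] (x : R) : ∀ u v : List ℕ, encR x (ladd u v) = encR x u + encR x v
  | [], v => by simp [ladd, encR]
  | a :: u, [] => by simp [ladd, encR]
  | a :: u, b :: v => by simp only [ladd, encR]; rw [encR_ladd x u v]; push_cast; ring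

/-- `encR` is homogeneous. [folklore] -/
theorem encR_map_mul {R : Type*} [CommRing R] (x : R) (a : ℕ) : ∀ b : List ℕ,
    encR x (b.map fun y => a * y) = (a : R) * encR x b
  | [] => by simp [encR]
  | y :: b => by simp only [List.map_cons, encR]; rw [encR_map_mul x a b]; push_cast; ring

/-- `encR` multiplies on `lconv`. [folklore] -/
theorem encR_lconv {R : Type*} [CommRing R] (x : R) : ∀ a b : List ℕ, encR x (lconv a b) = encR x a * encR x b
  | [], b => by simp [lconv, encR]
  | y :: a, b => by
    simp only [lconv, encR]
    rw [encR_ladd, encR_map_mul, encR, encR_lconv x a b]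
    push_cast; ring

/-- `encR` as a sum over positions. [folklore] -/
theorem encR_eq_sum {R : Type*} [CommRing R] (x : R) : ∀ l : List ℕ,
    encR x l = ∑ i ∈ range l.length, (l.getD i 0 : R) * x ^ i
  | [] => by simp [encR]
  | a :: l => by
    rw [encR, encR_eq_sum x l, List.length_cons, Finset.sum_range_succ']
    simp only [List.getD_cons_succ, List.getD_cons_zero, pow_zero, mul_one, pow_succ]
    rw [Finset.mul_sum, add_comm]
    exact congrArg (· + (a : R)) (Finset.sum_congr rfl fun i _ => by ring)

/-- A sum over positions may be extended past the end of the list. [folklore] -/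
theorem sum_getD_extend {R : Type*} [CommRing R] (x : R) (l : List ℕ) {n : ℕ} (hn : l.length ≤ n) :
    ∑ i ∈ range n, (l.getD i 0 : R) * x ^ i = ∑ i ∈ range l.length, (l.getD i 0 : R) * x ^ i := by
  obtain ⟨k, rfl⟩ := Nat.exists_eq_add_of_le hn
  rw [Finset.sum_range_add, add_eq_left]
  refine Finset.sum_eq_zero fun i _ => ?_
  rw [List.getD_eq_default _ _ (by omega), Nat.cast_zero, zero_mul]

/-- `enc 1` is the sum. [folklore] -/
theorem enc_one : ∀ l : List ℕ, enc 1 l = l.sum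
  | [] => rfl
  | a :: l => by rw [enc, enc_one l, one_mul, List.sum_cons]

/-- The entries of a linear convolution sum to the product of the sums. [folklore] -/
theorem sum_lconv (a b : List ℕ) : (lconv a b).sum = a.sum * b.sum := by
  rw [← enc_one, enc_lconv, enc_one, enc_one]

/-- The entries of `ladd u v` sum to the sum of the sums. [folklore] -/
theorem sum_ladd (u v : List ℕ) : (ladd u v).sum = u.sum + v.sum := by
  rw [← enc_one, enc_ladd, enc_one, enc_one]

/-- `enc` of an append. [folklore] -/
theorem enc_append (u v : List ℕ) : enc X (u ++ v) = enc X u + X ^ u.length * enc X v := by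
  induction u with
  | nil => simp [enc]
  | cons a u ih => rw [List.cons_append, enc, enc, ih, List.length_cons, pow_succ]; ring

/-- `enc` of a list with digits `< X` is below `X^length`. [folklore] -/
theorem enc_lt : ∀ u : List ℕ, (∀ a ∈ u, a < X) → enc X u < X ^ u.length
  | [], _ => by simp [enc]
  | a :: u, h => by
    rw [enc, List.length_cons, pow_succ]
    have ha : a < X := h a (by simp)
    have hu := enc_lt u fun b hb => h b (by simp [hb])
    have : enc X u + 1 ≤ X ^ u.length := hu
    nlinarith

/-- Two distinct entries are bounded by the sum. [folklore] -/
theorem getD_add_getD_le_sum : ∀ (l : List ℕ) (i j : ℕ), i ≠ j → l.getD i 0 + l.getD j 0 ≤ l.sum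
  | [], i, j, _ => by simp
  | a :: l, 0, 0, h => absurd rfl h
  | a :: l, 0, j + 1, _ => by
    rw [List.getD_cons_zero, List.getD_cons_succ, List.sum_cons]
    exact Nat.add_le_add_left (getD_le_sum l j) a
  | a :: l, i + 1, 0, _ => by
    rw [List.getD_cons_zero, List.getD_cons_succ, List.sum_cons, add_comm]
    exact Nat.add_le_add_left (getD_le_sum l i) a
  | a :: l, i + 1, j + 1, h => by
    rw [List.getD_cons_succ, List.getD_cons_succ, List.sum_cons]
    exact le_add_left (getD_add_getD_le_sum l i j fun e => h (by rw [e]))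

/-- Length of `ladd`. [folklore] -/
theorem length_ladd : ∀ u v : List ℕ, (ladd u v).length = max u.length v.length
  | [], v => by simp [ladd]
  | x :: u, [] => by simp [ladd]
  | x :: u, y :: v => by simp [ladd, length_ladd u v, Nat.succ_max_succ]

/-- Length of `lconv`. [folklore] -/
theorem length_lconv_le : ∀ a b : List ℕ, (lconv a b).length ≤ a.length + b.length
  | [], b => by simp [lconv]
  | y :: a, b => by
    simp only [lconv, length_ladd, List.length_map, List.length_cons]
    have := length_lconv_le a b
    omega

/-- `encR` of an append. [folklore] -/
theorem encR_append {R : Type*} [CommRing R] (x : R) (u v : List ℕ) :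
    encR x (u ++ v) = encR x u + x ^ u.length * encR x v := by
  induction u with
  | nil => simp [encR]
  | cons a u ih => rw [List.cons_append, encR, encR, ih, List.length_cons, pow_succ]; ring

/-- Splitting a packed list at position `p`: low part. [folklore] -/
theorem enc_mod_pow (hX : 0 < X) (L : List ℕ) (hL : ∀ a ∈ L, a < X) (p : ℕ) :
    enc X L % X ^ p = enc X (L.take p) := by
  conv_lhs => rw [← List.take_append_drop p L]
  rw [enc_append]
  have hlt : enc X (L.take p) < X ^ (L.take p).length := enc_lt _ fun a ha => hL a (List.mem_of_mem_take ha)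
  by_cases hp : p ≤ L.length
  · rw [List.length_take, min_eq_left hp] at hlt ⊢
    rw [Nat.add_mul_mod_self_left, Nat.mod_eq_of_lt hlt]
  · rw [not_le] at hp
    rw [List.drop_eq_nil_of_le hp.le, enc, mul_zero, add_zero, Nat.mod_eq_of_lt]
    rw [List.length_take, min_eq_right hp.le] at hlt
    exact lt_of_lt_of_le hlt (Nat.pow_le_pow_right hX hp.le)

/-- Splitting a packed list at position `p`: high part. [folklore] -/
theorem enc_div_pow (hX : 0 < X) (L : List ℕ) (hL : ∀ a ∈ L, a < X) (p : ℕ) :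
    enc X L / X ^ p = enc X (L.drop p) := by
  conv_lhs => rw [← List.take_append_drop p L]
  rw [enc_append]
  have hlt : enc X (L.take p) < X ^ (L.take p).length := enc_lt _ fun a ha => hL a (List.mem_of_mem_take ha)
  have hXp : 0 < X ^ p := Nat.pow_pos hX
  by_cases hp : p ≤ L.length
  · rw [List.length_take, min_eq_left hp] at hlt ⊢
    rw [Nat.add_mul_div_left _ _ hXp, Nat.div_eq_of_lt hlt, zero_add]
  · rw [not_le] at hp
    rw [List.drop_eq_nil_of_le hp.le, enc, mul_zero, add_zero, Nat.div_eq_of_lt]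
    rw [List.length_take, min_eq_right hp.le] at hlt
    exact lt_of_lt_of_le hlt (Nat.pow_le_pow_right hX hp.le)

/-- The digit list of `enc L` (digits `< X`, length `≤ p`) is `L` padded with zeros. [folklore] -/
theorem dl_enc (hX : 0 < X) {p : ℕ} (L : List ℕ) (hL : ∀ a ∈ L, a < X) :
    dl p X (enc X L) = (List.range p).map fun v => L.getD v 0 := by
  unfold dl
  exact List.map_congr_left fun v _ => digit_enc hX L v hL

/-- Entries of a digit list are `< X`. [folklore] -/
theorem dl_lt (hX : 0 < X) {p a : ℕ} : ∀ x ∈ dl p X a, x < X := by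
  intro x hx
  unfold dl at hx
  rw [List.mem_map] at hx
  obtain ⟨v, _, rfl⟩ := hx
  exact Nat.mod_lt _ hX

/-- Entries of the digit list. [folklore] -/
theorem dl_getD {p a v : ℕ} (hv : v < p) : (dl p X a).getD v 0 = a / X ^ v % X := by
  unfold dl; exact getD_range_map _ hv _

/-- Length of the digit list. [folklore] -/
theorem length_dl (p a : ℕ) : (dl p X a).length = p := by unfold dl; simp

/-- A numeral below `X^p` is the packing of its digit list. [folklore] -/
theorem enc_dl {p a : ℕ} (ha : a < X ^ p) : enc X (dl p X a) = a := by
  induction p generalizing a with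
  | zero =>
    rw [pow_zero] at ha
    have : a = 0 := by omega
    subst this; rfl
  | succ p ih =>
    have e : dl (p + 1) X a = a % X :: dl p X (a / X) := by
      unfold dl
      rw [List.range_succ_eq_map, List.map_cons, List.map_map, pow_zero, Nat.div_one]
      congr 1
      exact List.map_congr_left fun v _ => by simp [Function.comp, pow_succ, Nat.div_div_eq_div_mul, mul_comm]
    rw [e, enc, ih (Nat.div_lt_of_lt_mul (by rw [← pow_succ']; exact ha))]
    exact Nat.mod_add_div a X

end Enc

end LineNorm

end Summit.MatrixMultiplication.OmegaCensus
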